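import Summits.AtomisticToContinuum.HydrodynamicLimit.Theorems.PolynomialCompression.Negative.Entropy

/-!
# The hard-sphere entropy in the dilute regime: `θ ≍ ρ^{2/3}` along every classical solution

Negative-side structure for the crux `ImplosionDichotomy.PolynomialCompression` (stmt-AtomisticToContinuum-12587),
from the standing disprover's `Cruxes/PolynomialCompression/Disproof.lean` §12 (cycle 4); specialisation of
`Negative/Entropy.lean` to the typed hard-sphere law. Under the UNBUNDLED `HsEosLowDensity` data `(η₀, F)`
(`hsExcessFreeEnergy = F` on `[0, η₀)`, `F` analytic on `(−η₀, η₀)`; a theorem of the tree for some `η₀ > 0`,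
`hsEosLowDensity_proof`, stmt-0768) and for `σ > 0`, on the density range `(0, η₀/σ³)` the typed compressibility
`ζ r = Z(rσ³)` and the excess free energy `G r = F(rσ³)` are smooth with `r G′ = ζ − 1` and the typed pressure is
`ρ θ ζ(ρ)` (`hs_eos_data`), so the specific entropy `(3/2) log θ − log ρ − F(ρσ³)` is transported along every
classical solution whose packing stays `< η₀`. Since the excess free energy is `≥ 0` (`hsExcessFreeEnergy_nonneg`:
the free volume is `≤ 1`), the entropy minimum principle gives the ADIABATIC TEMPERATURE FLOOR
`θ(t,x) ≥ e^{2k/3} ρ(t,x)^{2/3}`, `k = min s(0,·)` (`hs_temperature_ge`), and the maximum principle the matching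
ceiling (`hs_temperature_le`): the temperature of a dilute classical hard-sphere flow is slaved to the density up to
constants fixed at `t = 0`. Also: the pressure field of such a solution is jointly smooth
(`hs_isSmoothSpaceTimeOn_pressure`, discharging the hypothesis of `Negative/Energy.lean` at the SAME radius `η₀`).
refuter-cdisprove-stmt-AtomisticToContinuum-12587-g4-0.
-/

noncomputable section

namespace Summit.AtomisticToContinuum.HydrodynamicLimit.Theorems

namespace PolynomialCompressionEntropy

open MeasureTheory Filter Set Topology
open scoped ContDiff
open Literature.MathematicalPhysics.KineticTheory Literature.Analysis.FluidPDE
open Literature.Analysis.FunctionSpaces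


section HardSphere

variable {η₀ : ℝ} {F : ℝ → ℝ}

/-- The excess free energy of the hard-sphere gas is nonnegative (the free volume is `≤ 1`, so every term
`-N⁻¹ log hsFreeVolume η N` of the `limsup` is `≥ 0`; an unbounded sequence has `limsup = sInf ∅ = 0` in `ℝ`).
[folklore] -/
theorem hsExcessFreeEnergy_nonneg (η : ℝ) : 0 ≤ hsExcessFreeEnergy η := by
  have hnn : ∀ N : ℕ, 0 ≤ -(N : ℝ)⁻¹ * Real.log (hsFreeVolume η N) := by
    intro N
    have h0 : 0 ≤ hsFreeVolume η N := by unfold hsFreeVolume; exact ENNReal.toReal_nonneg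
    have h1 : Real.log (hsFreeVolume η N) ≤ 0 := Real.log_nonpos h0 (hsFreeVolume_le_one η N)
    have h2 : 0 ≤ (N : ℝ)⁻¹ := inv_nonneg.2 (Nat.cast_nonneg N)
    nlinarith
  unfold hsExcessFreeEnergy
  by_cases hb : IsBoundedUnder (· ≤ ·) atTop (fun N : ℕ => -(N : ℝ)⁻¹ * Real.log (hsFreeVolume η N))
  · exact le_limsup_of_frequently_le (Frequently.of_forall hnn) hb
  · rw [Filter.limsup_eq]
    have hemp : {a : ℝ | ∀ᶠ N : ℕ in atTop, -(N : ℝ)⁻¹ * Real.log (hsFreeVolume η N) ≤ a} = ∅ := by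
      ext a
      simp only [mem_setOf_eq, mem_empty_iff_false, iff_false]
      exact fun ha => hb ⟨a, ha⟩
    rw [hemp, Real.sInf_empty]

/-- **The hard-sphere law in the dilute regime, unbundled.** Under the `HsEosLowDensity` data `(η₀, F)` and for
`σ > 0`: on the density range `J = (0, η₀/σ³)` (packing `< η₀`) the compressibility `ζ r = Z(rσ³)` and the excess
free energy `G r = F(rσ³)` are smooth, `r G′(r) = ζ(r) − 1` (i.e. `Z = 1 + ηF′(η)`), and the typed pressure is
`ρ θ ζ(ρ)`. [folklore] -/
theorem hs_eos_data (hη₀ : 0 < η₀) (hF : AnalyticOnNhd ℝ F (Ioo (-η₀) η₀))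
    (hEq : EqOn hsExcessFreeEnergy F (Ico 0 η₀)) {σ : ℝ} (hσ : 0 < σ) :
    IsOpen (Ioo 0 (η₀ / σ ^ 3)) ∧
    ContDiffOn ℝ ∞ (fun r => hsCompressibility (r * σ ^ 3)) (Ioo 0 (η₀ / σ ^ 3)) ∧
    ContDiffOn ℝ ∞ (fun r => F (r * σ ^ 3)) (Ioo 0 (η₀ / σ ^ 3)) ∧
    (∀ r ∈ Ioo 0 (η₀ / σ ^ 3), r * deriv (fun r => F (r * σ ^ 3)) r = hsCompressibility (r * σ ^ 3) - 1) ∧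
    (∀ r ϑ : ℝ, hsPressure σ r ϑ = r * ϑ * hsCompressibility (r * σ ^ 3)) := by
  have hs3 : 0 < σ ^ 3 := pow_pos hσ 3
  have hmem : ∀ r ∈ Ioo 0 (η₀ / σ ^ 3), r * σ ^ 3 ∈ Ioo 0 η₀ := fun r hr =>
    ⟨mul_pos hr.1 hs3, (lt_div_iff₀ hs3).1 hr.2⟩
  have hmem' : ∀ r ∈ Ioo 0 (η₀ / σ ^ 3), r * σ ^ 3 ∈ Ioo (-η₀) η₀ := fun r hr =>
    ⟨(neg_lt_zero.2 hη₀).trans (hmem r hr).1, (hmem r hr).2⟩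
  have hderiv : ∀ η ∈ Ioo 0 η₀, deriv hsExcessFreeEnergy η = deriv F η := fun η hη =>
    (hEq.eventuallyEq_of_mem (mem_of_superset (Ioo_mem_nhds hη.1 hη.2) Ioo_subset_Ico_self)).deriv_eq
  have hZ : ∀ η ∈ Ioo 0 η₀, hsCompressibility η = 1 + η * deriv F η := fun η hη => by
    unfold hsCompressibility; rw [hderiv η hη]
  have hZf : ContDiffOn ℝ ∞ (fun η => 1 + η * deriv F η) (Ioo (-η₀) η₀) :=
    contDiffOn_const.add (contDiffOn_id.mul hF.deriv.contDiffOn_of_completeSpace)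
  have hlin : ContDiffOn ℝ ∞ (fun r : ℝ => r * σ ^ 3) (Ioo 0 (η₀ / σ ^ 3)) :=
    contDiffOn_id.mul contDiffOn_const
  refine ⟨isOpen_Ioo, ?_, ?_, ?_, fun r ϑ => rfl⟩
  · exact (hZf.comp hlin hmem').congr fun r hr => hZ _ (hmem r hr)
  · exact hF.contDiffOn_of_completeSpace.comp hlin hmem'
  · intro r hr
    have hFd : HasDerivAt F (deriv F (r * σ ^ 3)) (r * σ ^ 3) :=
      (hF _ (hmem' r hr)).differentiableAt.hasDerivAt
    have hG : HasDerivAt (fun r => F (r * σ ^ 3)) (deriv F (r * σ ^ 3) * (1 * σ ^ 3)) r :=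
      hFd.comp r ((hasDerivAt_id r).mul_const (σ ^ 3))
    rw [hG.deriv, hZ _ (hmem r hr)]
    ring

/-- **NO COLD COMPRESSION, pointwise.** Under the `HsEosLowDensity` data `(η₀, F)`: along every classical
hard-sphere-Euler solution at `σ > 0` whose packing stays `< η₀`, a lower bound `k` of the specific entropy
`(3/2) log θ − log ρ − F(ρσ³)` at `t = 0` gives `θ(t,x) ≥ e^{2k/3} ρ(t,x)^{2/3}` on `[0,T) × 𝕋³` (entropy minimum
principle + `F ≥ 0` on `[0, η₀)`). [folklore] -/
theorem hs_temperature_ge (hη₀ : 0 < η₀) (hF : AnalyticOnNhd ℝ F (Ioo (-η₀) η₀))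
    (hEq : EqOn hsExcessFreeEnergy F (Ico 0 η₀)) {σ T : ℝ} {ρ θ : ℝ → T3 → ℝ} {u : ℝ → T3 → V3}
    (hσ : 0 < σ) (hE : IsHardSphereEulerSolution σ T ρ u θ) (hpack : ∀ t ∈ Ico 0 T, ∀ x, ρ t x * σ ^ 3 < η₀)
    {k : ℝ} (hk : ∀ y, k ≤ 3 / 2 * Real.log (θ 0 y) - Real.log (ρ 0 y) - F (ρ 0 y * σ ^ 3))
    {t : ℝ} (ht : t ∈ Ico 0 T) (x : T3) :
    Real.exp (2 / 3 * k) * ρ t x ^ (2 / 3 : ℝ) ≤ θ t x := by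
  obtain ⟨hJ, hζ, hG, hG', hp⟩ := hs_eos_data hη₀ hF hEq hσ
  have hρJ : ∀ t ∈ Ico 0 T, ∀ x, ρ t x ∈ Ioo 0 (η₀ / σ ^ 3) := fun t ht x =>
    ⟨hE.density_pos t ht x, (lt_div_iff₀ (pow_pos hσ 3)).2 (hpack t ht x)⟩
  have hge := ent_ge_of_forall_ge hE hJ hζ hρJ (fun t _ x => hp _ _) hG hG' (k := k) (fun y => hk y) ht x
  have hFnn : 0 ≤ F (ρ t x * σ ^ 3) := by
    rw [← hEq ⟨(mul_pos (hE.density_pos t ht x) (pow_pos hσ 3)).le, hpack t ht x⟩]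
    exact hsExcessFreeEnergy_nonneg _
  have hθ := hE.temperature_pos t ht x
  have hρ := hE.density_pos t ht x
  unfold ent at hge
  have h1 : 2 / 3 * k + Real.log (ρ t x) * (2 / 3) ≤ Real.log (θ t x) := by linarith
  calc Real.exp (2 / 3 * k) * ρ t x ^ (2 / 3 : ℝ)
      = Real.exp (2 / 3 * k + Real.log (ρ t x) * (2 / 3)) := by
        rw [Real.exp_add, Real.rpow_def_of_pos hρ]
    _ ≤ Real.exp (Real.log (θ t x)) := Real.exp_le_exp.2 h1
    _ = θ t x := Real.exp_log hθ

/-- **NO OVERHEATING BEYOND THE ADIABAT, pointwise** (the other side): with an upper bound `K` of the specific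
entropy at `t = 0` and `F ≤ B` on the packing range `[0, η₁]`, `η₁ < η₀`, every such solution with packing `≤ η₁`
obeys `θ(t,x) ≤ e^{2(K+B)/3} ρ(t,x)^{2/3}` (entropy maximum principle). Together with `hs_temperature_ge`:
`θ ≍ ρ^{2/3}` along every dilute classical solution, with constants fixed at `t = 0`. [folklore] -/
theorem hs_temperature_le (hη₀ : 0 < η₀) (hF : AnalyticOnNhd ℝ F (Ioo (-η₀) η₀))
    (hEq : EqOn hsExcessFreeEnergy F (Ico 0 η₀)) {η₁ B : ℝ} (hη₁ : η₁ < η₀) (hFB : ∀ η ∈ Icc 0 η₁, F η ≤ B)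
    {σ T : ℝ} {ρ θ : ℝ → T3 → ℝ} {u : ℝ → T3 → V3}
    (hσ : 0 < σ) (hE : IsHardSphereEulerSolution σ T ρ u θ) (hpack : ∀ t ∈ Ico 0 T, ∀ x, ρ t x * σ ^ 3 ≤ η₁)
    {K : ℝ} (hK : ∀ y, 3 / 2 * Real.log (θ 0 y) - Real.log (ρ 0 y) - F (ρ 0 y * σ ^ 3) ≤ K)
    {t : ℝ} (ht : t ∈ Ico 0 T) (x : T3) :
    θ t x ≤ Real.exp (2 / 3 * (K + B)) * ρ t x ^ (2 / 3 : ℝ) := by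
  obtain ⟨hJ, hζ, hG, hG', hp⟩ := hs_eos_data hη₀ hF hEq hσ
  have hpack' : ∀ t ∈ Ico 0 T, ∀ x, ρ t x * σ ^ 3 < η₀ := fun t ht x => (hpack t ht x).trans_lt hη₁
  have hρJ : ∀ t ∈ Ico 0 T, ∀ x, ρ t x ∈ Ioo 0 (η₀ / σ ^ 3) := fun t ht x =>
    ⟨hE.density_pos t ht x, (lt_div_iff₀ (pow_pos hσ 3)).2 (hpack' t ht x)⟩
  have hle := ent_le_of_forall_le hE hJ hζ hρJ (fun t _ x => hp _ _) hG hG' (K := K) (fun y => hK y) ht x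
  have hFB' : F (ρ t x * σ ^ 3) ≤ B :=
    hFB _ ⟨(mul_pos (hE.density_pos t ht x) (pow_pos hσ 3)).le, hpack t ht x⟩
  have hθ := hE.temperature_pos t ht x
  have hρ := hE.density_pos t ht x
  unfold ent at hle
  have h1 : Real.log (θ t x) ≤ 2 / 3 * (K + B) + Real.log (ρ t x) * (2 / 3) := by linarith
  calc θ t x = Real.exp (Real.log (θ t x)) := (Real.exp_log hθ).symm
    _ ≤ Real.exp (2 / 3 * (K + B) + Real.log (ρ t x) * (2 / 3)) := Real.exp_le_exp.2 h1
    _ = Real.exp (2 / 3 * (K + B)) * ρ t x ^ (2 / 3 : ℝ) := by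
        rw [Real.exp_add, Real.rpow_def_of_pos hρ]

/-- Under the `HsEosLowDensity` data, the pressure field of a dilute classical solution is jointly smooth (so the
energy-conservation lemmas of `Negative/Energy.lean` apply). [folklore] -/
theorem hs_isSmoothSpaceTimeOn_pressure (hη₀ : 0 < η₀) (hF : AnalyticOnNhd ℝ F (Ioo (-η₀) η₀))
    (hEq : EqOn hsExcessFreeEnergy F (Ico 0 η₀)) {σ T : ℝ} {ρ θ : ℝ → T3 → ℝ} {u : ℝ → T3 → V3}
    (hσ : 0 < σ) (hE : IsHardSphereEulerSolution σ T ρ u θ) (hpack : ∀ t ∈ Ico 0 T, ∀ x, ρ t x * σ ^ 3 < η₀) :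
    Torus.IsSmoothSpaceTimeOn (Ico 0 T) (fun t y => hsPressure σ (ρ t y) (θ t y)) := by
  obtain ⟨-, hζ, -, -, hp⟩ := hs_eos_data hη₀ hF hEq hσ
  have hρJ : ∀ t ∈ Ico 0 T, ∀ x, ρ t x ∈ Ioo 0 (η₀ / σ ^ 3) := fun t ht x =>
    ⟨hE.density_pos t ht x, (lt_div_iff₀ (pow_pos hσ 3)).2 (hpack t ht x)⟩
  have h := (hE.smooth_density.mul hE.smooth_temperature).mul
    (isSmoothSpaceTimeOn_comp_density hE.smooth_density hζ hρJ)
  have hfun : (fun t y => hsPressure σ (ρ t y) (θ t y)) =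
      fun t y => ρ t y * θ t y * hsCompressibility (ρ t y * σ ^ 3) := by
    funext t y; exact hp _ _
  rw [hfun]
  exact h

end HardSphere

end PolynomialCompressionEntropy

end Summit.AtomisticToContinuum.HydrodynamicLimit.Theorems

end
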